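import Literature.Analysis.FluidPDE.SelfSimilarLiouville
import Literature.Analysis.FluidPDE.TsaiGrowthLemmas
import Literature.Analysis.FluidPDE.TsaiHeadPressureIdentity
import Literature.Analysis.FluidPDE.HarmonicLiouvilleLp
import HarnessLib

/-!
# Nečas–Růžička–Šverák 1996 (Leray profiles in `L³(ℝ³)` vanish): the decomposition

Analysis/FluidPDE file (family NS, statement ns.S21) decomposing the named fact
`Literature.Analysis.FluidPDE.necas_ruzicka_sverak` of `SelfSimilarLiouville.lean` — J. Nečas,
M. Růžička, V. Šverák, *On Leray's self-similar solutions of the Navier–Stokes equations*, Acta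
Math. 176 (1996) 283–294, **Theorem 1** (p. 291): "Let `U` be a weak solution of (1.3) belonging
to `L³(ℝ³)`. Then `U ≡ 0` in `ℝ³`." Here (1.3) is Leray's profile system
`−νΔU + aU + a(y·∇)U + (U·∇)U + ∇P = 0`, `div U = 0` (`ν > 0`, `a > 0`), rendered in the tree by
the pointwise class `IsLerayProfile ν a U P` (`U ∈ C²`, `P ∈ C¹`; `SelfSimilar.lean`).

## The printed proof and this decomposition

NRŠ prove Theorem 1 from four numbered results: **Proposition 2.1** (ε-regularity with all
derivatives for smooth Navier–Stokes solutions on a parabolic cylinder, from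
Caffarelli–Kohn–Nirenberg's Proposition 1 and Serrin's interior regularity), **Lemma 2.2** (a
limit lemma for Riesz transforms), **Lemma 3.1** (an `L³` weak solution `U` and
`P := RⱼRₖ(UⱼUₖ)` are smooth, `P ∈ L^{3/2}`, and (1.3) holds pointwise), **Lemma 3.2** (decay:
`|∇ᵏU(y)| = O(|y|^{-3-k})`, `|∇ᵏP(y)| = O(|y|^{-2-k})`), **Lemma 3.3** (the head pressure
`Π = ½|U|² + P + a y·U` satisfies `−νΔΠ + ((U + ay)·∇)Π ≤ 0`, hence the maximum principle), and
then conclude (p. 291) either with Lemma 2.2 (`0 ≥ lim ∫ Π φ_ε = (½ − ⅓)∫|U|²`) or, in their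
"alternative proof" (pp. 291–292), with the integral identity (3.12). Tsai (ARMA 143 (1998), §5,
pp. 48–49) replaced the endgame by a Liouville-type lemma: `Π = O(|y|^N)` and `U = o(|y|)` force
`Π ≡ const` (his Lemma 5.1), whence `curl U = 0`, `ΔU = 0`, and `U ∈ L³` harmonic vanishes. The
tree holds, **proved**, Tsai's Lemma 5.1 (`isConst_of_driftOp_nonneg_of_poly`,
`TsaiMaximumPrinciple.lean`), the `L^q` Liouville theorem (`eq_zero_of_harmonic_memLp_inner`,
`HarmonicLiouvilleLp.lean`), and — from the decomposition of Tsai's Theorem 1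
(`tsai_selfsimilar`) — the head pressure `headPressure a U P` with NRŠ's Lemma 3.3 / Tsai's (1.7)
as the identity `ν ΔΠ − DΠ[U + a y] = ν(|∇U|² − tr (∇U)²) ≥ 0` and the step "`Π` constant ⟹
`ΔU = 0`" for smooth profiles (`IsLerayProfile.driftOp_headPressure_nonneg`,
`IsLerayProfile.laplacian_eq_zero_of_headPressure_const`, `TsaiHeadPressureIdentity.lean`), and,
as a named fact, the regularity remark "every weak solution of (1.3) is smooth"
(`tsai1998_profile_smooth`, `TsaiGrowthLemmas.lean`; Tsai, p. 33, quotes it from the stationary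
Navier–Stokes theory exactly as NRŠ do on p. 287 — one fact serves both theorems). Accordingly:

* the one remaining analytic input specific to NRŠ is vendored here as a **named fact**,
  rendered for the pointwise class (see its docstring for the reading): `nrs1996_lemma32`
  (Lemma 3.2 with Lemma 3.1: decay of `U` and of `P −` const for `U ∈ L³` — CKN partial
  regularity);
* **proved** here: the assembly
  `necas_ruzicka_sverak_of_nrs1996 : tsai1998_profile_smooth → nrs1996_lemma32 →
  necas_ruzicka_sverak` (with the elementary `exists_forall_norm_le_of_decay`: decay at infinity
  plus continuity gives boundedness).

Once the two facts are discharged, `necas_ruzicka_sverak_holds` is this implication applied to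
their `_holds` theorems. Natural next inputs for `nrs1996_lemma32`: the tree's named fact
`lemarieRieusset_epsilon_regularity` (`CKNEpsilonRegularity.lean`, the `k = 0` case of NRŠ's
Proposition 2.1) and a higher-regularity (Serrin) statement.

## Design notes

* **Statement of the fact untouched.** `necas_ruzicka_sverak` quantifies over `C²`/`C¹`
  pointwise profile pairs `(U, P)` with `U ∈ L³`; such a `U` is a weak solution in NRŠ's sense
  (pp. 286–287: `U ∈ W^{1,2}_loc`, `div U = 0`, the identity against divergence-free test fields,
  from which every gradient drops out), so Theorem 1 applies verbatim. The given `P` need not be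
  NRŠ's `RⱼRₖ(UⱼUₖ)`, but it has the same gradient, which is why `nrs1996_lemma32` renders the
  pressure decay as that of `P − c` for some constant `c`; the assembly only uses that `U` and
  `P` are bounded (`k = 0`).
* **Regularity.** The identity file works with `U ∈ C^∞` (and proves `P ∈ C^∞` from it,
  `IsLerayProfile.contDiff_pressure_of_smooth`); `tsai1998_profile_smooth` supplies `U ∈ C^∞`.
* **History.** A pre-maintenance proposal `p14692` (`NecasRuzickaSverak.lean`, old namespaces,
  NRŠ's alternative proof with Lemma 3.3 kept as a third named fact) was bounced for the rename
  and is superseded by this file, where Lemma 3.3 is the tree's proved identity.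

## Mathlib / tree search

Mathlib (this pin): `contDiff_infty`, `norm_iteratedFDeriv_zero`,
`IsCompact.exists_bound_of_continuousOn`, `abs_real_inner_le_norm`; no Navier–Stokes,
self-similar, ε-regularity or Riesz-transform theory. Tree: `necas_ruzicka_sverak`,
`IsLerayProfile` (`SelfSimilarLiouville`, `SelfSimilar`); `tsai1998_profile_smooth`
(`TsaiGrowthLemmas`); `headPressure`, `headPressure_apply`,
`IsLerayProfile.contDiff_pressure_of_smooth` (`TsaiHeadPressure`);
`IsLerayProfile.contDiff_headPressure`, `IsLerayProfile.driftOp_headPressure_nonneg`,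
`IsLerayProfile.laplacian_eq_zero_of_headPressure_const` (`TsaiHeadPressureIdentity`); `driftOp`,
`isConst_of_driftOp_nonneg_of_poly` (`TsaiMaximumPrinciple`); `eq_zero_of_harmonic_memLp_inner`,
`harmonicOnNhd_of_laplacian_eq_zero` (`HarmonicLiouvilleLp`); `lemarieRieusset_epsilon_regularity`
(`CKNEpsilonRegularity`, not imported). `lean search 'necas'`, `'nrs1996'`, `'Lemma 3.2'`: no
earlier rendering of NRŠ's Lemma 3.2 in the tree (Tsai's `tsai1998_lemma32`/`_lemma33` are the
weaker growth statements for `L^q`, `q > 3`).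

## References

* J. Nečas, M. Růžička, V. Šverák, *On Leray's self-similar solutions of the Navier–Stokes
  equations*, Acta Math. 176 (1996) 283–294: (1.3) p. 283; Proposition 2.1 p. 284; Lemma 2.2
  p. 286; weak solutions and their smoothness pp. 286–287; Lemma 3.1 p. 287; Lemma 3.2
  pp. 288–290; Lemma 3.3 p. 290; Theorem 1 and the alternative proof pp. 291–292
  [NecasRuzickaSverak1996].
* T.-P. Tsai, *On Leray's self-similar solutions of the Navier–Stokes equations satisfying local
  energy estimates*, Arch. Rational Mech. Anal. 143 (1998) 29–51: (1.7)–(1.8) pp. 31–32, p. 33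
  (regularity); Lemma 5.1 and the proof of Theorems 1 and 2, (5.2), pp. 47–49 [Tsai1998].
* P. G. Lemarié-Rieusset, *The Navier–Stokes problem in the 21st century*, CRC Press (2016),
  §16.8, Theorem 16.8 and Lemma 16.8 (the same architecture for Tsai's theorem)
  [LemarieRieusset2016].
-/

noncomputable section

open MeasureTheory Set Filter Topology InnerProductSpace Function Metric
open scoped RealInnerProductSpace Laplacian ContDiff

namespace Literature.Analysis.FluidPDE

/-! ### The analytic input (named fact) -/

/-- **NRŠ 1996, Lemma 3.2 (decay of `L³` profiles), read through Lemma 3.1** (Acta Math. 176,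
pp. 287–290). Lemma 3.1: if `U ∈ L³(ℝ³)` is a weak solution of (1.3) and `P := RⱼRₖ(UⱼUₖ)`
(Riesz transforms), then `U` and `P` are smooth, `P ∈ L^{3/2}(ℝ³)` and
`−νΔU + aU + a(y·∇)U + (U·∇)U + ∇P = 0` in `ℝ³`. Lemma 3.2: for these `U`, `P` and each
`k = 0, 1, 2, …`, `|∇ᵏU(y)| = O(|y|^{−3−k})` and `|∇ᵏP(y)| = O(|y|^{−2−k})` as `|y| → ∞`
(proof pp. 288–290: pass to the self-similar Navier–Stokes solution (3.3)–(3.4); the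
ε-regularity Proposition 2.1 — Caffarelli–Kohn–Nirenberg's Proposition 1 with Serrin's higher
interior regularity — applies near every `(x₀, T)`, `x₀ ≠ 0`, because `U ∈ L³`, `P ∈ L^{3/2}`
(3.5); Hölder estimates for `p` from `−Δp = ∂ᵢ∂ⱼ(uᵢuⱼ)`; `∇ᵏ∂ₜu` bounded; `u(·, t) → 0` on
annuli as `t → T⁻` by `U ∈ L³` and Arzelà–Ascoli; hence `|∇ᵏu| ≤ Mₖ(T − t)` (3.9),
`|∇ᵏp| ≤ Mₖ` (3.10), and rescale). Rendered for the tree's pointwise class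
`IsLerayProfile ν a U P` (`ν > 0`, `a > 0` as in print) with `U ∈ L³`: such a `U` is a weak
solution in `L³`, so `U` decays as printed; the given `P ∈ C¹` has the same gradient as the
smooth `RⱼRₖ(UⱼUₖ)` (both equal `νΔU − aU − a(y·∇)U − (U·∇)U` pointwise), hence differs from it
by a constant `c` on the connected space `ℝ³`, and `P − c` decays like the printed pressure.
`|∇ᵏf(y)|` is rendered by the norm of the `k`-th Fréchet derivative `iteratedFDeriv ℝ k f y`, and
"`= O(|y|^{−m})` as `|y| → ∞`" by "`≤ C/|y|^m` for `|y| ≥ R`" (the witness may and should take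
`R > 0`). Deep (CKN partial regularity); not in Mathlib. [cite: NecasRuzickaSverak1996, Lemma 3.2 (with Lemma 3.1)] -/
def nrs1996_lemma32 : Prop :=
  ∀ {ν a : ℝ} (_hν : 0 < ν) (_ha : 0 < a)
    {U : EuclideanSpace ℝ (Fin 3) → EuclideanSpace ℝ (Fin 3)} {P : EuclideanSpace ℝ (Fin 3) → ℝ}
    (_hprof : IsLerayProfile ν a U P) (_hU : MemLp U 3),
    (∀ k : ℕ, ∃ C R : ℝ, ∀ y, R ≤ ‖y‖ → ‖iteratedFDeriv ℝ k U y‖ ≤ C / ‖y‖ ^ (3 + k)) ∧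
    ∃ c : ℝ, ∀ k : ℕ, ∃ C R : ℝ, ∀ y, R ≤ ‖y‖ →
      ‖iteratedFDeriv ℝ k (fun z => P z - c) y‖ ≤ C / ‖y‖ ^ (2 + k)

/-! ### Proved glue -/

section Decay

variable {E : Type*} [NormedAddCommGroup E] [InnerProductSpace ℝ E] [FiniteDimensional ℝ E]

/-- A continuous function with `‖f(y)‖ ≤ C/‖y‖ᵏ` for `‖y‖ ≥ R` is bounded (compactness of the
closed ball of radius `max R 1`). [folklore] -/
theorem exists_forall_norm_le_of_decay {F : Type*} [NormedAddCommGroup F] {f : E → F}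
    (hf : Continuous f) {C R : ℝ} {k : ℕ} (hdec : ∀ y, R ≤ ‖y‖ → ‖f y‖ ≤ C / ‖y‖ ^ k) :
    ∃ M, 0 ≤ M ∧ ∀ y, ‖f y‖ ≤ M := by
  set R₁ := max R 1 with hR₁
  obtain ⟨M₀, hM₀⟩ := (isCompact_closedBall (0 : E) R₁).exists_bound_of_continuousOn hf.continuousOn
  refine ⟨max (max M₀ |C|) 0, le_max_right _ _, fun y => ?_⟩
  by_cases hy : ‖y‖ ≤ R₁
  · exact (hM₀ y (mem_closedBall_zero_iff.2 hy)).trans ((le_max_left _ _).trans (le_max_left _ _))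
  · have hy' : R₁ < ‖y‖ := not_le.1 hy
    have hy1 : 1 ≤ ‖y‖ := (le_max_right _ _).trans hy'.le
    have hR : R ≤ ‖y‖ := (le_max_left _ _).trans hy'.le
    have hpow : 1 ≤ ‖y‖ ^ k := one_le_pow₀ hy1
    calc ‖f y‖ ≤ C / ‖y‖ ^ k := hdec y hR
      _ ≤ |C| / ‖y‖ ^ k := by gcongr; exact le_abs_self C
      _ ≤ |C| := div_le_self (abs_nonneg _) hpow
      _ ≤ max (max M₀ |C|) 0 := (le_max_right _ _).trans (le_max_left _ _)

end Decay

/-! ### The assembly: Theorem 1 from its analytic inputs -/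

/-- **NRŠ 1996, Theorem 1, from its analytic inputs.** Granted the regularity of weak solutions
of (1.3) (NRŠ p. 287 = Tsai p. 33, the tree's `tsai1998_profile_smooth`) and Lemma 3.2
(`nrs1996_lemma32`), every Leray profile `U ∈ L³(ℝ³)` vanishes (`necas_ruzicka_sverak`). The
argument is the maximum-principle proof of NRŠ 1996 (Lemma 3.3, Theorem 1) in the form given by
Tsai 1998, §5 (proof of Theorems 1 and 2, pp. 48–49), every step of which is proved in the tree:
`U`, `P` are `C^∞` (`tsai1998_profile_smooth`, `IsLerayProfile.contDiff_pressure_of_smooth`); the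
head pressure `Π = ½|U|² + P + a y·U` is smooth with `ν ΔΠ − (U + a y)·∇Π ≥ 0`
(`IsLerayProfile.driftOp_headPressure_nonneg`, NRŠ Lemma 3.3 / Tsai (1.7)); by Lemma 3.2 (`k = 0`)
and continuity, `U` and `P` are bounded, so `|U(y)| ≤ (a/2)|y|` for `|y| ≥ 2M/a` and
`|Π(y)| ≤ K(1 + |y|)`; Tsai's Liouville-type Lemma 5.1 (`isConst_of_driftOp_nonneg_of_poly`)
makes `Π` constant; hence `ΔU = 0` (`IsLerayProfile.laplacian_eq_zero_of_headPressure_const`);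
and a harmonic field in `L³(ℝ³)` is zero (`eq_zero_of_harmonic_memLp_inner`, "the usual
Liouville theorem", Tsai p. 49). [cite: NecasRuzickaSverak1996, Thm 1 (p. 291)] -/
theorem necas_ruzicka_sverak_of_nrs1996 (hA : tsai1998_profile_smooth) (hB : nrs1996_lemma32) :
    necas_ruzicka_sverak := by
  intro ν a hν ha U P hprof hU3
  have hUs : ContDiff ℝ ∞ U := hA hν ha hprof
  have hPs : ContDiff ℝ ∞ P := hprof.contDiff_pressure_of_smooth hUs
  have hU2 : ContDiff ℝ 2 U := (contDiff_infty.1 hUs) 2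
  have hUc : Continuous U := hUs.continuous
  have hPc : Continuous P := hPs.continuous
  obtain ⟨hdecU, c, hdecP⟩ := hB hν ha hprof hU3
  -- `U` and `P` are bounded (Lemma 3.2 with `k = 0` and continuity)
  obtain ⟨CU, RU, hCU⟩ := hdecU 0
  obtain ⟨CP, RP, hCP⟩ := hdecP 0
  obtain ⟨M, hM0, hM⟩ : ∃ M, 0 ≤ M ∧ ∀ y, ‖U y‖ ≤ M := by
    refine exists_forall_norm_le_of_decay hUc (C := CU) (R := RU) (k := 3 + 0) fun y hy => ?_
    rw [← norm_iteratedFDeriv_zero (𝕜 := ℝ)]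
    exact hCU y hy
  obtain ⟨MP, hMP0, hMP⟩ : ∃ MP, 0 ≤ MP ∧ ∀ y, |P y| ≤ MP := by
    obtain ⟨M₁, hM₁0, hM₁⟩ := exists_forall_norm_le_of_decay (hPc.sub continuous_const)
      (C := CP) (R := RP) (k := 2 + 0) fun y hy => by
        rw [← norm_iteratedFDeriv_zero (𝕜 := ℝ)]
        exact hCP y hy
    refine ⟨M₁ + |c|, by positivity, fun y => ?_⟩
    have h1 : |P y - c| ≤ M₁ := by simpa [Real.norm_eq_abs] using hM₁ y
    calc |P y| = |(P y - c) + c| := by rw [sub_add_cancel]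
      _ ≤ |P y - c| + |c| := abs_add_le _ _
      _ ≤ M₁ + |c| := by gcongr
  -- the head pressure is a smooth subsolution of the drift operator (NRŠ Lemma 3.3)
  set Θ : EuclideanSpace ℝ (Fin 3) → ℝ := headPressure a U P with hΘ
  have hΘ2 : ContDiff ℝ 2 Θ := (contDiff_infty.1 (hprof.contDiff_headPressure hUs)) 2
  have hsub : ∀ y, 0 ≤ driftOp ν a U Θ y := fun y =>
    hprof.driftOp_headPressure_nonneg hUs hν.le y
  -- sublinear drift: `|U(y)| ≤ (a/2)|y|` for `|y| ≥ 2M/a`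
  have hUlin : ∀ y, 2 * M / a ≤ ‖y‖ → ‖U y‖ ≤ a / 2 * ‖y‖ := by
    intro y hy
    rw [div_le_iff₀ ha] at hy
    calc ‖U y‖ ≤ M := hM y
      _ ≤ a / 2 * ‖y‖ := by linarith
  -- linear growth of `Θ`
  have hgrowth : ∀ y, |Θ y| ≤ (2⁻¹ * M ^ 2 + MP + a * M) * (1 + ‖y‖) ^ 1 := by
    intro y
    rw [pow_one, hΘ, headPressure_apply]
    have h1 : |2⁻¹ * ‖U y‖ ^ 2| ≤ 2⁻¹ * M ^ 2 := by
      rw [abs_of_nonneg (by positivity)]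
      gcongr
      exact hM y
    have h2 : |a * ⟪y, U y⟫| ≤ a * M * ‖y‖ := by
      rw [abs_mul, abs_of_pos ha, mul_assoc]
      gcongr
      calc |⟪y, U y⟫| ≤ ‖y‖ * ‖U y‖ := abs_real_inner_le_norm _ _
        _ ≤ ‖y‖ * M := by gcongr; exact hM y
        _ = M * ‖y‖ := mul_comm _ _
    have hy0 : 0 ≤ ‖y‖ := norm_nonneg y
    calc |2⁻¹ * ‖U y‖ ^ 2 + P y + a * ⟪y, U y⟫|
        ≤ |2⁻¹ * ‖U y‖ ^ 2| + |P y| + |a * ⟪y, U y⟫| := abs_add_three _ _ _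
      _ ≤ 2⁻¹ * M ^ 2 + MP + a * M * ‖y‖ := by gcongr; exact hMP y
      _ ≤ (2⁻¹ * M ^ 2 + MP + a * M) * (1 + ‖y‖) := by
        nlinarith [mul_nonneg ha.le hM0, sq_nonneg M]
  -- Tsai's Liouville-type lemma: `Θ` is constant
  have hconst : ∀ x y, Θ x = Θ y :=
    isConst_of_driftOp_nonneg_of_poly (b := a / 2) hν (by positivity) (by linarith) hΘ2 hUc hsub
      hUlin hgrowth
  -- hence `ΔU = 0`, and a harmonic field in `L³` vanishes
  have hΔ : ∀ y, Δ U y = 0 :=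
    hprof.laplacian_eq_zero_of_headPressure_const hUs hν.ne' hconst
  exact eq_zero_of_harmonic_memLp_inner (harmonicOnNhd_of_laplacian_eq_zero hU2 hΔ)
    (by norm_num) (by norm_num) hU3

end Literature.Analysis.FluidPDE

end
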